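import Summits.CriticalPhenomena.PercolationContinuityZ3.Theorems.PercNearOneGluingNoHeavyQuantElemSymmBound
import HarnessLib

/-!
# QUANT lane R8, T-DEC: THE MASSES OF THE WIDTH-5 SUB-FLOOR HUB `S(γ₁) ∗ ⋯ ∗ S(γ₅)` of shape `{lo, lo+K; γ}` — the Poisson-binomial values at the six atoms
# `5lo + sK` (census-1 gen 35)

builds on p205010 (kernel theorem, internal audit signed; external expert review pending)

Support file (`--supports stmt-CriticalPhenomena-4575`), QUANT lane seat prim-quant-census-1 (gen 35); memo
`run/shared/lean/prim/quant/prim-quant-census-1/g35/QUADHUB-G35.md` §4.  Theorems only, standard axioms, no sorries.  For the route/SDEC files of the width-5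
long-tail hub (successor of `…QuantLongTailQuadHub`): the explicit polynomial masses `u₀..u₅` of `sHub lo K [γ₁, γ₂, γ₃, γ₄, γ₅]` at `5lo, 5lo+K, …, 5lo+5K`, read off
gen 31's elementary-symmetric formula `sHub_mass_esL` (`u(lo·5 + K·t) = Π(1−γᵢ)·e_t(odds)`) by clearing the odds' denominators (`field_simp; ring`) — this avoids
the layer-by-layer `lconv_sp_apply` bookkeeping of the width-3/4 files.
* `sHub_five_mass0` … `sHub_five_mass5` — `sHub lo K [γ₁..γ₅] (5lo + sK) = u_s(γ)` for gates `γᵢ ∈ [0,1)`, `lo < K`.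

HONEST STATUS.  Bookkeeping; `SiblingStep`, `GluedDominatedMass`, `SDECConvClosed`, `FarTreeRow` OPEN; RATE class (log\*) / honest sentence of
`run/shared/lean/prim/quant/README.md` unchanged.  [this work].  Nothing here is cited as a published result.  The gluing rows served
[cite: KozmaNitzan2024, Conjecture 3 (p. 15)]; product measure [cite: Grimmett1999, §1.3 p. 10].
-/

noncomputable section
open scoped BigOperators

namespace Summit.CriticalPhenomena.PercolationContinuityZ3.Theorems
namespace Quant
namespace LawDec

/-- the width-5 hub mass at `5·lo`: `u_0` = the Poisson-binomial probability of `0` giant pieces among the five. [this work] -/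
theorem sHub_five_mass0 (lo K : ℕ) (hloK : lo < K) (γ₁ γ₂ γ₃ γ₄ γ₅ : ℝ)
    (h1 : 0 ≤ γ₁ ∧ γ₁ < 1) (h2 : 0 ≤ γ₂ ∧ γ₂ < 1) (h3 : 0 ≤ γ₃ ∧ γ₃ < 1) (h4 : 0 ≤ γ₄ ∧ γ₄ < 1) (h5 : 0 ≤ γ₅ ∧ γ₅ < 1) :
    sHub lo K [γ₁, γ₂, γ₃, γ₄, γ₅] (5 * lo) =
      (1 - γ₁) * (1 - γ₂) * (1 - γ₃) * (1 - γ₄) * (1 - γ₅) := by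
  have hP : ∀ γ ∈ [γ₁, γ₂, γ₃, γ₄, γ₅], 0 ≤ γ ∧ γ < 1 := by
    intro γ hγ; simp only [List.mem_cons, List.mem_nil_iff, or_false] at hγ
    rcases hγ with rfl | rfl | rfl | rfl | rfl; exacts [h1, h2, h3, h4, h5]
  have h := sHub_mass_esL lo K hloK [γ₁, γ₂, γ₃, γ₄, γ₅] hP 0
  have e5 : ([γ₁, γ₂, γ₃, γ₄, γ₅] : List ℝ).length = 5 := rfl
  rw [e5] at h
  simp only [List.map_cons, List.map_nil, List.prod_cons, List.prod_nil, esL_zero] at h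
  rw [show 5 * lo = lo * 5 + K * 0 by ring, h]
  ring

/-- the width-5 hub mass at `5·lo+K`: `u_1` = the Poisson-binomial probability of `1` giant pieces among the five. [this work] -/
theorem sHub_five_mass1 (lo K : ℕ) (hloK : lo < K) (γ₁ γ₂ γ₃ γ₄ γ₅ : ℝ)
    (h1 : 0 ≤ γ₁ ∧ γ₁ < 1) (h2 : 0 ≤ γ₂ ∧ γ₂ < 1) (h3 : 0 ≤ γ₃ ∧ γ₃ < 1) (h4 : 0 ≤ γ₄ ∧ γ₄ < 1) (h5 : 0 ≤ γ₅ ∧ γ₅ < 1) :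
    sHub lo K [γ₁, γ₂, γ₃, γ₄, γ₅] (5 * lo + K) =
      γ₁ * (1 - γ₂) * (1 - γ₃) * (1 - γ₄) * (1 - γ₅) + γ₂ * (1 - γ₁) * (1 - γ₃) * (1 - γ₄) * (1 - γ₅) + γ₃ * (1 - γ₁) * (1 - γ₂) * (1 - γ₄) * (1 - γ₅)
      + γ₄ * (1 - γ₁) * (1 - γ₂) * (1 - γ₃) * (1 - γ₅) + γ₅ * (1 - γ₁) * (1 - γ₂) * (1 - γ₃) * (1 - γ₄) := by
  have hP : ∀ γ ∈ [γ₁, γ₂, γ₃, γ₄, γ₅], 0 ≤ γ ∧ γ < 1 := by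
    intro γ hγ; simp only [List.mem_cons, List.mem_nil_iff, or_false] at hγ
    rcases hγ with rfl | rfl | rfl | rfl | rfl; exacts [h1, h2, h3, h4, h5]
  have h := sHub_mass_esL lo K hloK [γ₁, γ₂, γ₃, γ₄, γ₅] hP (0 + 1)
  have e5 : ([γ₁, γ₂, γ₃, γ₄, γ₅] : List ℝ).length = 5 := rfl
  rw [e5] at h
  simp only [List.map_cons, List.map_nil, List.prod_cons, List.prod_nil, esL_cons_succ, esL_zero, esL_nil_succ] at h
  rw [show 5 * lo + K = lo * 5 + K * (0 + 1) by ring, h]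
  have n1 : 1 - γ₁ ≠ 0 := by linarith [h1.2]
  have n2 : 1 - γ₂ ≠ 0 := by linarith [h2.2]
  have n3 : 1 - γ₃ ≠ 0 := by linarith [h3.2]
  have n4 : 1 - γ₄ ≠ 0 := by linarith [h4.2]
  have n5 : 1 - γ₅ ≠ 0 := by linarith [h5.2]
  field_simp
  ring

/-- the width-5 hub mass at `5·lo+2·K`: `u_2` = the Poisson-binomial probability of `2` giant pieces among the five. [this work] -/
theorem sHub_five_mass2 (lo K : ℕ) (hloK : lo < K) (γ₁ γ₂ γ₃ γ₄ γ₅ : ℝ)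
    (h1 : 0 ≤ γ₁ ∧ γ₁ < 1) (h2 : 0 ≤ γ₂ ∧ γ₂ < 1) (h3 : 0 ≤ γ₃ ∧ γ₃ < 1) (h4 : 0 ≤ γ₄ ∧ γ₄ < 1) (h5 : 0 ≤ γ₅ ∧ γ₅ < 1) :
    sHub lo K [γ₁, γ₂, γ₃, γ₄, γ₅] (5 * lo + 2 * K) =
      γ₁ * γ₂ * (1 - γ₃) * (1 - γ₄) * (1 - γ₅) + γ₁ * γ₃ * (1 - γ₂) * (1 - γ₄) * (1 - γ₅) + γ₁ * γ₄ * (1 - γ₂) * (1 - γ₃) * (1 - γ₅)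
      + γ₁ * γ₅ * (1 - γ₂) * (1 - γ₃) * (1 - γ₄) + γ₂ * γ₃ * (1 - γ₁) * (1 - γ₄) * (1 - γ₅) + γ₂ * γ₄ * (1 - γ₁) * (1 - γ₃) * (1 - γ₅)
      + γ₂ * γ₅ * (1 - γ₁) * (1 - γ₃) * (1 - γ₄) + γ₃ * γ₄ * (1 - γ₁) * (1 - γ₂) * (1 - γ₅) + γ₃ * γ₅ * (1 - γ₁) * (1 - γ₂) * (1 - γ₄)
      + γ₄ * γ₅ * (1 - γ₁) * (1 - γ₂) * (1 - γ₃) := by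
  have hP : ∀ γ ∈ [γ₁, γ₂, γ₃, γ₄, γ₅], 0 ≤ γ ∧ γ < 1 := by
    intro γ hγ; simp only [List.mem_cons, List.mem_nil_iff, or_false] at hγ
    rcases hγ with rfl | rfl | rfl | rfl | rfl; exacts [h1, h2, h3, h4, h5]
  have h := sHub_mass_esL lo K hloK [γ₁, γ₂, γ₃, γ₄, γ₅] hP (0 + 1 + 1)
  have e5 : ([γ₁, γ₂, γ₃, γ₄, γ₅] : List ℝ).length = 5 := rfl
  rw [e5] at h
  simp only [List.map_cons, List.map_nil, List.prod_cons, List.prod_nil, esL_cons_succ, esL_zero, esL_nil_succ] at h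
  rw [show 5 * lo + 2 * K = lo * 5 + K * (0 + 1 + 1) by ring, h]
  have n1 : 1 - γ₁ ≠ 0 := by linarith [h1.2]
  have n2 : 1 - γ₂ ≠ 0 := by linarith [h2.2]
  have n3 : 1 - γ₃ ≠ 0 := by linarith [h3.2]
  have n4 : 1 - γ₄ ≠ 0 := by linarith [h4.2]
  have n5 : 1 - γ₅ ≠ 0 := by linarith [h5.2]
  field_simp
  ring

/-- the width-5 hub mass at `5·lo+3·K`: `u_3` = the Poisson-binomial probability of `3` giant pieces among the five. [this work] -/
theorem sHub_five_mass3 (lo K : ℕ) (hloK : lo < K) (γ₁ γ₂ γ₃ γ₄ γ₅ : ℝ)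
    (h1 : 0 ≤ γ₁ ∧ γ₁ < 1) (h2 : 0 ≤ γ₂ ∧ γ₂ < 1) (h3 : 0 ≤ γ₃ ∧ γ₃ < 1) (h4 : 0 ≤ γ₄ ∧ γ₄ < 1) (h5 : 0 ≤ γ₅ ∧ γ₅ < 1) :
    sHub lo K [γ₁, γ₂, γ₃, γ₄, γ₅] (5 * lo + 3 * K) =
      γ₁ * γ₂ * γ₃ * (1 - γ₄) * (1 - γ₅) + γ₁ * γ₂ * γ₄ * (1 - γ₃) * (1 - γ₅) + γ₁ * γ₂ * γ₅ * (1 - γ₃) * (1 - γ₄) + γ₁ * γ₃ * γ₄ * (1 - γ₂) * (1 - γ₅)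
      + γ₁ * γ₃ * γ₅ * (1 - γ₂) * (1 - γ₄) + γ₁ * γ₄ * γ₅ * (1 - γ₂) * (1 - γ₃) + γ₂ * γ₃ * γ₄ * (1 - γ₁) * (1 - γ₅) + γ₂ * γ₃ * γ₅ * (1 - γ₁) * (1 - γ₄)
      + γ₂ * γ₄ * γ₅ * (1 - γ₁) * (1 - γ₃) + γ₃ * γ₄ * γ₅ * (1 - γ₁) * (1 - γ₂) := by
  have hP : ∀ γ ∈ [γ₁, γ₂, γ₃, γ₄, γ₅], 0 ≤ γ ∧ γ < 1 := by
    intro γ hγ; simp only [List.mem_cons, List.mem_nil_iff, or_false] at hγ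
    rcases hγ with rfl | rfl | rfl | rfl | rfl; exacts [h1, h2, h3, h4, h5]
  have h := sHub_mass_esL lo K hloK [γ₁, γ₂, γ₃, γ₄, γ₅] hP (0 + 1 + 1 + 1)
  have e5 : ([γ₁, γ₂, γ₃, γ₄, γ₅] : List ℝ).length = 5 := rfl
  rw [e5] at h
  simp only [List.map_cons, List.map_nil, List.prod_cons, List.prod_nil, esL_cons_succ, esL_zero, esL_nil_succ] at h
  rw [show 5 * lo + 3 * K = lo * 5 + K * (0 + 1 + 1 + 1) by ring, h]
  have n1 : 1 - γ₁ ≠ 0 := by linarith [h1.2]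
  have n2 : 1 - γ₂ ≠ 0 := by linarith [h2.2]
  have n3 : 1 - γ₃ ≠ 0 := by linarith [h3.2]
  have n4 : 1 - γ₄ ≠ 0 := by linarith [h4.2]
  have n5 : 1 - γ₅ ≠ 0 := by linarith [h5.2]
  field_simp
  ring

/-- the width-5 hub mass at `5·lo+4·K`: `u_4` = the Poisson-binomial probability of `4` giant pieces among the five. [this work] -/
theorem sHub_five_mass4 (lo K : ℕ) (hloK : lo < K) (γ₁ γ₂ γ₃ γ₄ γ₅ : ℝ)
    (h1 : 0 ≤ γ₁ ∧ γ₁ < 1) (h2 : 0 ≤ γ₂ ∧ γ₂ < 1) (h3 : 0 ≤ γ₃ ∧ γ₃ < 1) (h4 : 0 ≤ γ₄ ∧ γ₄ < 1) (h5 : 0 ≤ γ₅ ∧ γ₅ < 1) :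
    sHub lo K [γ₁, γ₂, γ₃, γ₄, γ₅] (5 * lo + 4 * K) =
      γ₁ * γ₂ * γ₃ * γ₄ * (1 - γ₅) + γ₁ * γ₂ * γ₃ * γ₅ * (1 - γ₄) + γ₁ * γ₂ * γ₄ * γ₅ * (1 - γ₃) + γ₁ * γ₃ * γ₄ * γ₅ * (1 - γ₂)
      + γ₂ * γ₃ * γ₄ * γ₅ * (1 - γ₁) := by
  have hP : ∀ γ ∈ [γ₁, γ₂, γ₃, γ₄, γ₅], 0 ≤ γ ∧ γ < 1 := by
    intro γ hγ; simp only [List.mem_cons, List.mem_nil_iff, or_false] at hγ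
    rcases hγ with rfl | rfl | rfl | rfl | rfl; exacts [h1, h2, h3, h4, h5]
  have h := sHub_mass_esL lo K hloK [γ₁, γ₂, γ₃, γ₄, γ₅] hP (0 + 1 + 1 + 1 + 1)
  have e5 : ([γ₁, γ₂, γ₃, γ₄, γ₅] : List ℝ).length = 5 := rfl
  rw [e5] at h
  simp only [List.map_cons, List.map_nil, List.prod_cons, List.prod_nil, esL_cons_succ, esL_zero, esL_nil_succ] at h
  rw [show 5 * lo + 4 * K = lo * 5 + K * (0 + 1 + 1 + 1 + 1) by ring, h]
  have n1 : 1 - γ₁ ≠ 0 := by linarith [h1.2]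
  have n2 : 1 - γ₂ ≠ 0 := by linarith [h2.2]
  have n3 : 1 - γ₃ ≠ 0 := by linarith [h3.2]
  have n4 : 1 - γ₄ ≠ 0 := by linarith [h4.2]
  have n5 : 1 - γ₅ ≠ 0 := by linarith [h5.2]
  field_simp
  ring

/-- the width-5 hub mass at `5·lo+5·K`: `u_5` = the Poisson-binomial probability of `5` giant pieces among the five. [this work] -/
theorem sHub_five_mass5 (lo K : ℕ) (hloK : lo < K) (γ₁ γ₂ γ₃ γ₄ γ₅ : ℝ)
    (h1 : 0 ≤ γ₁ ∧ γ₁ < 1) (h2 : 0 ≤ γ₂ ∧ γ₂ < 1) (h3 : 0 ≤ γ₃ ∧ γ₃ < 1) (h4 : 0 ≤ γ₄ ∧ γ₄ < 1) (h5 : 0 ≤ γ₅ ∧ γ₅ < 1) :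
    sHub lo K [γ₁, γ₂, γ₃, γ₄, γ₅] (5 * lo + 5 * K) =
      γ₁ * γ₂ * γ₃ * γ₄ * γ₅ := by
  have hP : ∀ γ ∈ [γ₁, γ₂, γ₃, γ₄, γ₅], 0 ≤ γ ∧ γ < 1 := by
    intro γ hγ; simp only [List.mem_cons, List.mem_nil_iff, or_false] at hγ
    rcases hγ with rfl | rfl | rfl | rfl | rfl; exacts [h1, h2, h3, h4, h5]
  have h := sHub_mass_esL lo K hloK [γ₁, γ₂, γ₃, γ₄, γ₅] hP (0 + 1 + 1 + 1 + 1 + 1)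
  have e5 : ([γ₁, γ₂, γ₃, γ₄, γ₅] : List ℝ).length = 5 := rfl
  rw [e5] at h
  simp only [List.map_cons, List.map_nil, List.prod_cons, List.prod_nil, esL_cons_succ, esL_zero, esL_nil_succ] at h
  rw [show 5 * lo + 5 * K = lo * 5 + K * (0 + 1 + 1 + 1 + 1 + 1) by ring, h]
  have n1 : 1 - γ₁ ≠ 0 := by linarith [h1.2]
  have n2 : 1 - γ₂ ≠ 0 := by linarith [h2.2]
  have n3 : 1 - γ₃ ≠ 0 := by linarith [h3.2]
  have n4 : 1 - γ₄ ≠ 0 := by linarith [h4.2]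
  have n5 : 1 - γ₅ ≠ 0 := by linarith [h5.2]
  field_simp
  ring

end LawDec
end Quant
end Summit.CriticalPhenomena.PercolationContinuityZ3.Theorems
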